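import Mathlib
import Literature.Analysis.PDE.Wave1DFarEnergySourced
import Literature.Analysis.PDE.FarKernelSpanLemmas
import Literature.Analysis.ODE.InverseSquareTailOperator
import Summits.FinalStateConjecture.FinalStateConjecture.Theorems.PhotonSphereChannelsExteriorEnergy

/-!
# Peeling, file 2: calculus on the half-plane `{x > a}`

Support file for `stub_peel` of the line `crum-peeling-recessive-tower` (crux
`UniformPhotonSphereChannelsR`, stmt-FinalStateConjecture-14074).  The peeled solutions live on the
open half-plane `H = ℝ_t × (a, ∞)` only, while the tree's two-variable calculus
(`Literature.Analysis.Calculus.exists_partials_of_contDiff_two`, the `WaveEnergy` slice dictionary,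
the sourced energy monotonicity `Literature.Analysis.PDE.wave1D_lintegral_Ioi_energy_mono_of_source`)
is stated for globally `C²` functions.  The bridge is a cut-off in `x`:

* `exists_halfPlane_extension` — a `C²` function on `H` agrees with a global `C²` function on every
  smaller half-plane `{x > (a+b)/2}`, `b > a`;
* `halfPlane_partials` — the partial derivatives of a `C²` function on `H` in the curried
  `deriv`/`iteratedDeriv` language of the route: existence, joint continuity, `C¹` regularity of
  the first partials, and Schwarz symmetry, all on `H`;
* `halfPlane_farEnergy_le_initial` — for a `C²` solution of `θ_tt − θ_xx + Uθ = 0` on `H` whose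
  potential is `≥ 0` on `[X₀, ∞)`, the far energy beyond the receding edge `c + |t|`, `c ≥ X₀`, is
  at most the initial far energy beyond `c` (lower Lebesgue integrals).
-/

noncomputable section

-- the doubled `FinalStateConjecture` component is the tree's fixed summit/problem path
set_option linter.dupNamespace false

namespace Summit.FinalStateConjecture.FinalStateConjecture.Theorems.CrumPeelingRecessiveTower

open MeasureTheory Set Filter Topology
open Summit.FinalStateConjecture.FinalStateConjecture.Theorems.WaveEnergy

/-! ### Cut-off extension from the half-plane -/

/-- A `C²` (indeed smooth) cut-off in one variable: `χ = 0` on `(−∞, a + (b−a)/4]` and `χ = 1` on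
`[(a+b)/2, ∞)`, for `a < b`. -/
theorem exists_halfLine_cutoff {a b : ℝ} (hab : a < b) :
    ∃ χ : ℝ → ℝ, ContDiff ℝ 2 χ ∧ (∀ x, x ≤ a + (b - a) / 4 → χ x = 0) ∧
      (∀ x, (a + b) / 2 ≤ x → χ x = 1) := by
  have hε : 0 < b - a := sub_pos.2 hab
  refine ⟨fun x => Real.smoothTransition ((x - a - (b - a) / 4) / ((b - a) / 4)), ?_, ?_, ?_⟩
  · exact (Real.smoothTransition.contDiff (n := 2)).comp
      (by fun_prop : ContDiff ℝ 2 (fun x : ℝ => (x - a - (b - a) / 4) / ((b - a) / 4)))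
  · intro x hx
    apply Real.smoothTransition.zero_of_nonpos
    exact div_nonpos_of_nonpos_of_nonneg (by linarith) (by linarith)
  · intro x hx
    apply Real.smoothTransition.one_of_one_le
    rw [le_div_iff₀ (by linarith)]
    linarith

/-- **Cut-off extension.** A function `C²` on the open half-plane `{x > a}` agrees, on the smaller
half-plane `{x > (a+b)/2}` (`b > a`), with a globally `C²` function on `ℝ²`. -/
theorem exists_halfPlane_extension {θ : ℝ → ℝ → ℝ} {a b : ℝ} (hab : a < b)
    (hθ : ContDiffOn ℝ 2 (Function.uncurry θ) {z : ℝ × ℝ | a < z.2}) :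
    ∃ Θ : ℝ × ℝ → ℝ, ContDiff ℝ 2 Θ ∧ ∀ z : ℝ × ℝ, (a + b) / 2 < z.2 → Θ z = θ z.1 z.2 := by
  obtain ⟨χ, hχ, hχ0, hχ1⟩ := exists_halfLine_cutoff hab
  have hH : IsOpen {z : ℝ × ℝ | a < z.2} := isOpen_lt continuous_const continuous_snd
  have hO : IsOpen {z : ℝ × ℝ | z.2 < a + (b - a) / 4} := isOpen_lt continuous_snd continuous_const
  refine ⟨fun z => χ z.2 * θ z.1 z.2, ?_, fun z hz => ?_⟩
  · rw [contDiff_iff_contDiffAt]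
    intro z
    by_cases hz : a < z.2
    · exact ((hχ.comp contDiff_snd).contDiffAt).mul (hθ.contDiffAt (hH.mem_nhds hz))
    · have hz' : z.2 < a + (b - a) / 4 := by linarith [not_lt.1 hz, sub_pos.2 hab]
      have hev : (fun w : ℝ × ℝ => χ w.2 * θ w.1 w.2) =ᶠ[𝓝 z] fun _ => 0 := by
        filter_upwards [hO.mem_nhds hz'] with w hw
        rw [hχ0 w.2 (le_of_lt hw), zero_mul]
      exact contDiffAt_const.congr_of_eventuallyEq hev
  · show χ z.2 * θ z.1 z.2 = θ z.1 z.2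
    rw [hχ1 z.2 hz.le, one_mul]

/-! ### Partial derivatives on the half-plane -/

/-- **Partial derivatives of a `C²` function on the half-plane `{x > a}`**, in the curried
one-variable language: there are `θt, θx, θtt, θtx, θxx`, jointly continuous on the half-plane,
with `θt, θx` of class `C¹` there, such that at every point `(t, x)` with `x > a`:
`∂_τ θ = θt`, `∂ₓ θ = θx`, `∂_τ θt = θtt`, `∂_τ θx = θtx = ∂ₓ θt` (Schwarz), `∂ₓ θx = θxx`, and
`iteratedDeriv 2` of the slices are `θtt`, `θxx`. -/
theorem halfPlane_partials {θ : ℝ → ℝ → ℝ} {a : ℝ}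
    (hθ : ContDiffOn ℝ 2 (Function.uncurry θ) {z : ℝ × ℝ | a < z.2}) :
    ∃ θt θx θtt θtx θxx : ℝ → ℝ → ℝ,
      ContinuousOn (Function.uncurry θt) {z : ℝ × ℝ | a < z.2} ∧
      ContinuousOn (Function.uncurry θx) {z : ℝ × ℝ | a < z.2} ∧
      ContinuousOn (Function.uncurry θtt) {z : ℝ × ℝ | a < z.2} ∧
      ContinuousOn (Function.uncurry θtx) {z : ℝ × ℝ | a < z.2} ∧
      ContinuousOn (Function.uncurry θxx) {z : ℝ × ℝ | a < z.2} ∧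
      ContDiffOn ℝ 1 (Function.uncurry θt) {z : ℝ × ℝ | a < z.2} ∧
      ContDiffOn ℝ 1 (Function.uncurry θx) {z : ℝ × ℝ | a < z.2} ∧
      (∀ t x, a < x → HasDerivAt (fun τ => θ τ x) (θt t x) t) ∧
      (∀ t x, a < x → HasDerivAt (θ t) (θx t x) x) ∧
      (∀ t x, a < x → HasDerivAt (fun τ => θt τ x) (θtt t x) t) ∧
      (∀ t x, a < x → HasDerivAt (fun τ => θx τ x) (θtx t x) t) ∧
      (∀ t x, a < x → HasDerivAt (θt t) (θtx t x) x) ∧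
      (∀ t x, a < x → HasDerivAt (θx t) (θxx t x) x) ∧
      (∀ t x, a < x → iteratedDeriv 2 (fun τ => θ τ x) t = θtt t x) ∧
      (∀ t x, a < x → iteratedDeriv 2 (θ t) x = θxx t x) := by
  -- canonical witnesses
  set θt : ℝ → ℝ → ℝ := fun t x => deriv (fun τ => θ τ x) t with hθt
  set θx : ℝ → ℝ → ℝ := fun t x => deriv (θ t) x with hθx
  set θtt : ℝ → ℝ → ℝ := fun t x => iteratedDeriv 2 (fun τ => θ τ x) t with hθtt
  set θxx : ℝ → ℝ → ℝ := fun t x => iteratedDeriv 2 (θ t) x with hθxx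
  set θtx : ℝ → ℝ → ℝ := fun t x => deriv (fun τ => θx τ x) t with hθtx
  -- local global extensions and the dictionary on `{x > m}`
  have key : ∀ x₀, a < x₀ → ∃ (Θ : ℝ × ℝ → ℝ) (m : ℝ), ContDiff ℝ 2 Θ ∧ m < x₀ ∧ a ≤ m ∧
      (∀ τ y, m < y → θ τ y = Θ (τ, y)) ∧
      (∀ τ y, m < y → θt τ y = fderiv ℝ Θ (τ, y) (1, 0)) ∧
      (∀ τ y, m < y → θx τ y = fderiv ℝ Θ (τ, y) (0, 1)) ∧
      (∀ τ y, m < y → θtt τ y = fderiv ℝ (fderiv ℝ Θ) (τ, y) (1, 0) (1, 0)) ∧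
      (∀ τ y, m < y → θxx τ y = fderiv ℝ (fderiv ℝ Θ) (τ, y) (0, 1) (0, 1)) ∧
      (∀ τ y, m < y → θtx τ y = fderiv ℝ (fderiv ℝ Θ) (τ, y) (1, 0) (0, 1)) := by
    intro x₀ hx₀
    obtain ⟨Θ, hΘ, hagree⟩ := exists_halfPlane_extension hx₀ hθ
    set m : ℝ := (a + x₀) / 2 with hm
    have hΘd : Differentiable ℝ Θ := differentiable_of_contDiff_two hΘ
    -- slices
    have hsl1 : ∀ y, m < y → (fun τ => θ τ y) = fun τ => Θ (τ, y) := fun y hy =>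
      funext fun τ => (hagree (τ, y) hy).symm
    have hsl2 : ∀ τ y, m < y → (θ τ) =ᶠ[𝓝 y] fun y' => Θ (τ, y') := by
      intro τ y hy
      filter_upwards [Ioi_mem_nhds hy] with y' hy'
      exact (hagree (τ, y') hy').symm
    have e1 : ∀ τ y, m < y → θt τ y = fderiv ℝ Θ (τ, y) (1, 0) := by
      intro τ y hy
      simp only [hθt]
      rw [hsl1 y hy]
      exact (hasDerivAt_slice_fst hΘd τ y).deriv
    have e2 : ∀ τ y, m < y → θx τ y = fderiv ℝ Θ (τ, y) (0, 1) := by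
      intro τ y hy
      simp only [hθx]
      rw [(hsl2 τ y hy).deriv_eq]
      exact (hasDerivAt_slice_snd hΘd τ y).deriv
    refine ⟨Θ, m, hΘ, by rw [hm]; linarith, by rw [hm]; linarith, fun τ y hy => (hagree (τ, y) hy).symm,
      e1, e2, fun τ y hy => ?_, fun τ y hy => ?_, fun τ y hy => ?_⟩
    · simp only [hθtt]
      rw [iteratedDeriv_succ, iteratedDeriv_one]
      have : deriv (fun τ => θ τ y) = fun τ => fderiv ℝ Θ (τ, y) (1, 0) :=
        funext fun τ => e1 τ y hy
      rw [this]
      exact (hasDerivAt_fderiv_apply_slice_fst hΘ (1, 0) τ y).deriv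
    · simp only [hθxx]
      rw [iteratedDeriv_succ, iteratedDeriv_one]
      have : deriv (θ τ) =ᶠ[𝓝 y] fun y' => fderiv ℝ Θ (τ, y') (0, 1) := by
        filter_upwards [Ioi_mem_nhds hy] with y' hy'
        exact e2 τ y' hy'
      rw [this.deriv_eq]
      exact (hasDerivAt_fderiv_apply_slice_snd hΘ (0, 1) τ y).deriv
    · simp only [hθtx]
      have : (fun σ => θx σ y) = fun σ => fderiv ℝ Θ (σ, y) (0, 1) :=
        funext fun σ => e2 σ y hy
      rw [this]
      exact (hasDerivAt_fderiv_apply_slice_fst hΘ (0, 1) τ y).deriv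
  -- joint regularity from the local representations
  have hnbhd : ∀ {t x m : ℝ}, m < x → ∀ᶠ w : ℝ × ℝ in 𝓝 (t, x), m < w.2 := fun {t x m} hmx =>
    (isOpen_lt continuous_const continuous_snd).mem_nhds (by exact hmx)
  have hC1t : ContDiffOn ℝ 1 (Function.uncurry θt) {z : ℝ × ℝ | a < z.2} := by
    intro z hz
    obtain ⟨Θ, m, hΘ, hmx, -, -, e1, -, -, -, -⟩ := key z.2 hz
    have hg : ContDiff ℝ 1 fun w : ℝ × ℝ => fderiv ℝ Θ w (1, 0) :=
      (hΘ.fderiv_right (m := 1) (by norm_num)).clm_apply contDiff_const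
    have hev : Function.uncurry θt =ᶠ[𝓝 z] fun w => fderiv ℝ Θ w (1, 0) := by
      filter_upwards [hnbhd (t := z.1) hmx] with w hw
      exact e1 w.1 w.2 hw
    exact (hg.contDiffAt.congr_of_eventuallyEq hev).contDiffWithinAt
  have hC1x : ContDiffOn ℝ 1 (Function.uncurry θx) {z : ℝ × ℝ | a < z.2} := by
    intro z hz
    obtain ⟨Θ, m, hΘ, hmx, -, -, -, e2, -, -, -⟩ := key z.2 hz
    have hg : ContDiff ℝ 1 fun w : ℝ × ℝ => fderiv ℝ Θ w (0, 1) :=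
      (hΘ.fderiv_right (m := 1) (by norm_num)).clm_apply contDiff_const
    have hev : Function.uncurry θx =ᶠ[𝓝 z] fun w => fderiv ℝ Θ w (0, 1) := by
      filter_upwards [hnbhd (t := z.1) hmx] with w hw
      exact e2 w.1 w.2 hw
    exact (hg.contDiffAt.congr_of_eventuallyEq hev).contDiffWithinAt
  have hcont2 : ∀ (v w : ℝ × ℝ) (F : ℝ → ℝ → ℝ),
      (∀ x₀, a < x₀ → ∃ (Θ : ℝ × ℝ → ℝ) (m : ℝ), ContDiff ℝ 2 Θ ∧ m < x₀ ∧
        ∀ τ y, m < y → F τ y = fderiv ℝ (fderiv ℝ Θ) (τ, y) v w) →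
      ContinuousOn (Function.uncurry F) {z : ℝ × ℝ | a < z.2} := by
    intro v w F hF z hz
    obtain ⟨Θ, m, hΘ, hmx, e⟩ := hF z.2 hz
    have hg : Continuous fun p : ℝ × ℝ => fderiv ℝ (fderiv ℝ Θ) p v w :=
      (((hΘ.fderiv_right (m := 1) (by norm_num)).continuous_fderiv (by norm_num)).clm_apply
        continuous_const).clm_apply continuous_const
    have hev : Function.uncurry F =ᶠ[𝓝 z] fun p => fderiv ℝ (fderiv ℝ Θ) p v w := by
      filter_upwards [hnbhd (t := z.1) hmx] with p hp
      exact e p.1 p.2 hp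
    exact (hg.continuousAt.congr_of_eventuallyEq hev).continuousWithinAt
  refine ⟨θt, θx, θtt, θtx, θxx, hC1t.continuousOn, hC1x.continuousOn, ?_, ?_, ?_, hC1t, hC1x,
    ?_, ?_, ?_, ?_, ?_, ?_, fun t x _ => rfl, fun t x _ => rfl⟩
  · refine hcont2 (1, 0) (1, 0) θtt fun x₀ hx₀ => ?_
    obtain ⟨Θ, m, hΘ, hmx, -, -, -, -, e3, -, -⟩ := key x₀ hx₀
    exact ⟨Θ, m, hΘ, hmx, e3⟩
  · refine hcont2 (1, 0) (0, 1) θtx fun x₀ hx₀ => ?_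
    obtain ⟨Θ, m, hΘ, hmx, -, -, -, -, -, -, e5⟩ := key x₀ hx₀
    exact ⟨Θ, m, hΘ, hmx, e5⟩
  · refine hcont2 (0, 1) (0, 1) θxx fun x₀ hx₀ => ?_
    obtain ⟨Θ, m, hΘ, hmx, -, -, -, -, -, e4, -⟩ := key x₀ hx₀
    exact ⟨Θ, m, hΘ, hmx, e4⟩
  · -- `∂_τ θ = θt`
    intro t x hx
    obtain ⟨Θ, m, hΘ, hmx, -, e0, e1, -, -, -, -⟩ := key x hx
    have h := hasDerivAt_slice_fst (differentiable_of_contDiff_two hΘ) t x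
    rw [← e1 t x hmx] at h
    have : (fun τ => Θ (τ, x)) = fun τ => θ τ x := funext fun τ => (e0 τ x hmx).symm
    rwa [this] at h
  · -- `∂ₓ θ = θx`
    intro t x hx
    obtain ⟨Θ, m, hΘ, hmx, -, e0, -, e2, -, -, -⟩ := key x hx
    have h := hasDerivAt_slice_snd (differentiable_of_contDiff_two hΘ) t x
    rw [← e2 t x hmx] at h
    refine h.congr_of_eventuallyEq ?_
    filter_upwards [Ioi_mem_nhds hmx] with y hy
    exact e0 t y hy
  · -- `∂_τ θt = θtt`
    intro t x hx
    obtain ⟨Θ, m, hΘ, hmx, -, -, e1, -, e3, -, -⟩ := key x hx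
    have h := hasDerivAt_fderiv_apply_slice_fst hΘ (1, 0) t x
    rw [← e3 t x hmx] at h
    have : (fun τ => fderiv ℝ Θ (τ, x) (1, 0)) = fun τ => θt τ x :=
      funext fun τ => (e1 τ x hmx).symm
    rwa [this] at h
  · -- `∂_τ θx = θtx`
    intro t x hx
    obtain ⟨Θ, m, hΘ, hmx, -, -, -, e2, -, -, e5⟩ := key x hx
    have h := hasDerivAt_fderiv_apply_slice_fst hΘ (0, 1) t x
    rw [← e5 t x hmx] at h
    have : (fun τ => fderiv ℝ Θ (τ, x) (0, 1)) = fun τ => θx τ x :=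
      funext fun τ => (e2 τ x hmx).symm
    rwa [this] at h
  · -- `∂ₓ θt = θtx` (Schwarz)
    intro t x hx
    obtain ⟨Θ, m, hΘ, hmx, -, -, e1, -, -, -, e5⟩ := key x hx
    have h := hasDerivAt_fderiv_apply_slice_snd hΘ (1, 0) t x
    rw [fderiv_fderiv_symm hΘ (t, x) (0, 1) (1, 0), ← e5 t x hmx] at h
    refine h.congr_of_eventuallyEq ?_
    filter_upwards [Ioi_mem_nhds hmx] with y hy
    exact e1 t y hy
  · -- `∂ₓ θx = θxx`
    intro t x hx
    obtain ⟨Θ, m, hΘ, hmx, -, -, -, e2, -, e4, -⟩ := key x hx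
    have h := hasDerivAt_fderiv_apply_slice_snd hΘ (0, 1) t x
    rw [← e4 t x hmx] at h
    refine h.congr_of_eventuallyEq ?_
    filter_upwards [Ioi_mem_nhds hmx] with y hy
    exact e2 t y hy

/-! ### Energy monotonicity on receding far half-lines for half-plane solutions -/

/-- **Far energy of a half-plane solution does not increase along the receding edge.**  Let `U` be
continuous on `(a, ∞)` and `≥ 0` on `[X₀, ∞)` (`a < X₀`), and let `θ` be `C²` on the half-plane
`{x > a}` solving `θ_tt − θ_xx + Uθ = 0` there.  Then for `c ≥ X₀` and every `t`:
`∫⁻_{x > c + |t|} (θ_t² + θ_x² + Uθ²)(t, ·) ≤ ∫⁻_{x > c} (θ_t² + θ_x² + Uθ²)(0, ·)`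
(cut off in `x`, freeze the potential below `X₀`, and apply the sourced monotonicity
`Literature.Analysis.PDE.wave1D_lintegral_Ioi_energy_mono_of_source`: the source lives in
`{x < X₀}`). -/
theorem halfPlane_farEnergy_le_initial {U : ℝ → ℝ} {θ : ℝ → ℝ → ℝ} {a X₀ : ℝ} (haX : a < X₀)
    (hU : ContinuousOn U (Ioi a)) (hU0 : ∀ x, X₀ ≤ x → 0 ≤ U x)
    (hθ : ContDiffOn ℝ 2 (Function.uncurry θ) {z : ℝ × ℝ | a < z.2})
    (hsol : ∀ t x, a < x →
      iteratedDeriv 2 (fun τ => θ τ x) t - iteratedDeriv 2 (θ t) x + U x * θ t x = 0)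
    {c : ℝ} (hc : X₀ ≤ c) (t : ℝ) :
    ∫⁻ x in Ioi (c + |t|), ENNReal.ofReal
        (deriv (fun τ => θ τ x) t ^ 2 + deriv (θ t) x ^ 2 + U x * θ t x ^ 2)
      ≤ ∫⁻ x in Ioi c, ENNReal.ofReal
        (deriv (fun τ => θ τ x) 0 ^ 2 + deriv (θ 0) x ^ 2 + U x * θ 0 x ^ 2) := by
  obtain ⟨Θ, hΘ, hagree⟩ := exists_halfPlane_extension haX hθ
  set m : ℝ := (a + X₀) / 2 with hm
  have hmX : m < X₀ := by rw [hm]; linarith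
  -- curried extension and frozen potential
  set Θc : ℝ → ℝ → ℝ := fun τ y => Θ (τ, y) with hΘc
  have hΘc2 : ContDiff ℝ 2 (Function.uncurry Θc) := by
    have : Function.uncurry Θc = Θ := by funext p; rfl
    rw [this]; exact hΘ
  set Vh : ℝ → ℝ := fun y => U (max y X₀) with hVh
  have hVhc : Continuous Vh :=
    Literature.Analysis.ODE.continuous_comp_max_of_continuousOn
      (hU.mono fun y hy => lt_of_lt_of_le haX hy)
  have hVh0 : ∀ y, 0 ≤ Vh y := fun y => hU0 _ (le_max_right _ _)
  -- the source
  set F : ℝ → ℝ → ℝ := fun τ y =>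
    iteratedDeriv 2 (fun σ => Θc σ y) τ - iteratedDeriv 2 (Θc τ) y + Vh y * Θc τ y with hF
  have hFc : Continuous (Function.uncurry F) :=
    Literature.Analysis.PDE.continuous_wave1D_residual hVhc hΘc2
  have hsol' : ∀ τ y, iteratedDeriv 2 (fun σ => Θc σ y) τ - iteratedDeriv 2 (Θc τ) y
      + Vh y * Θc τ y = F τ y := fun τ y => rfl
  -- slices of `Θc` agree with those of `θ` beyond `m`
  have hsl1 : ∀ y, m < y → (fun σ => Θc σ y) = fun σ => θ σ y := fun y hy =>
    funext fun σ => hagree (σ, y) hy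
  have hsl2 : ∀ τ y, m < y → (Θc τ) =ᶠ[𝓝 y] θ τ := by
    intro τ y hy
    filter_upwards [Ioi_mem_nhds hy] with y' hy'
    exact hagree (τ, y') hy'
  have hVy : ∀ y, X₀ ≤ y → Vh y = U y := fun y hy => by simp only [hVh, max_eq_left hy]
  have hF0 : ∀ τ y, X₀ ≤ y → F τ y = 0 := by
    intro τ y hy
    have hmy : m < y := hmX.trans_le hy
    simp only [hF]
    rw [hsl1 y hmy, (hsl2 τ y hmy).iteratedDeriv_eq, hVy y hy]
    have hΘy : Θc τ y = θ τ y := hagree (τ, y) hmy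
    rw [hΘy]
    exact hsol τ y (haX.trans_le hy)
  -- the energy densities agree beyond `m`
  have hdens : ∀ τ y, X₀ ≤ y →
      deriv (fun σ => Θc σ y) τ ^ 2 + deriv (Θc τ) y ^ 2 + Vh y * Θc τ y ^ 2
        = deriv (fun σ => θ σ y) τ ^ 2 + deriv (θ τ) y ^ 2 + U y * θ τ y ^ 2 := by
    intro τ y hy
    have hmy : m < y := hmX.trans_le hy
    have hΘy : Θc τ y = θ τ y := hagree (τ, y) hmy
    rw [hsl1 y hmy, (hsl2 τ y hmy).deriv_eq, hVy y hy, hΘy]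
  rcases le_total 0 t with ht | ht
  · have h := Literature.Analysis.PDE.wave1D_lintegral_Ioi_energy_mono_of_source hVhc hVh0 hFc
      hΘc2 hsol' (c := c) (s := 0) (t := t) ht (fun τ y hy => hF0 τ y (by linarith))
    rw [add_zero] at h
    rw [abs_of_nonneg ht]
    refine le_trans (le_of_eq ?_) (h.trans (le_of_eq ?_))
    · refine setLIntegral_congr_fun measurableSet_Ioi fun y hy => ?_
      rw [hdens t y (by linarith [mem_Ioi.1 hy])]
    · refine setLIntegral_congr_fun measurableSet_Ioi fun y hy => ?_
      rw [hdens 0 y (hc.trans (le_of_lt hy))]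
  · have h := Literature.Analysis.PDE.wave1D_lintegral_Ioi_energy_mono_of_source_backward hVhc
      hVh0 hFc hΘc2 hsol' (c := c) (s := 0) (t := t) ht (fun τ y hy => hF0 τ y (by linarith))
    rw [sub_zero] at h
    rw [abs_of_nonpos ht, ← sub_eq_add_neg]
    refine le_trans (le_of_eq ?_) (h.trans (le_of_eq ?_))
    · refine setLIntegral_congr_fun measurableSet_Ioi fun y hy => ?_
      rw [hdens t y (by linarith [mem_Ioi.1 hy])]
    · refine setLIntegral_congr_fun measurableSet_Ioi fun y hy => ?_
      rw [hdens 0 y (hc.trans (le_of_lt hy))]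

/-- Registered sub-goal `peel_halfPlaneFarEnergy` of `stub_peel` (verbatim signature): the far
energy of a half-plane solution beyond the receding edge `c + |t|` is at most the initial far
energy beyond `c`, once the potential is nonnegative on `[X₀, ∞)` and `c ≥ X₀`. -/
theorem peel_halfPlaneFarEnergy : ∀ (U : ℝ → ℝ) (θ : ℝ → ℝ → ℝ) (a X₀ : ℝ), a < X₀ →
    ContinuousOn U (Set.Ioi a) → (∀ x, X₀ ≤ x → 0 ≤ U x) →
    ContDiffOn ℝ 2 (Function.uncurry θ) {z : ℝ × ℝ | a < z.2} →
    (∀ t x, a < x →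
      iteratedDeriv 2 (fun τ => θ τ x) t - iteratedDeriv 2 (θ t) x + U x * θ t x = 0) →
    ∀ c : ℝ, X₀ ≤ c → ∀ t : ℝ,
      MeasureTheory.lintegral (MeasureTheory.volume.restrict (Set.Ioi (c + |t|)))
          (fun x => ENNReal.ofReal
            (deriv (fun τ => θ τ x) t ^ 2 + deriv (θ t) x ^ 2 + U x * θ t x ^ 2))
        ≤ MeasureTheory.lintegral (MeasureTheory.volume.restrict (Set.Ioi c))
          (fun x => ENNReal.ofReal
            (deriv (fun τ => θ τ x) 0 ^ 2 + deriv (θ 0) x ^ 2 + U x * θ 0 x ^ 2)) :=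
  fun _ _ _ _ haX hU hU0 hθ hsol _ hc t => halfPlane_farEnergy_le_initial haX hU hU0 hθ hsol hc t

end Summit.FinalStateConjecture.FinalStateConjecture.Theorems.CrumPeelingRecessiveTower
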